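import Summits.QuantumFields.YangMills.Theorems.BalabanUVNodesN13UV01LevelZeroAtRecord13Chi
import Literature.MathematicalPhysics.QuantumFieldTheory.Balaban1983to89.Node00.Record13NumericsOfThm1CCMWZBChi
import Literature.MathematicalPhysics.QuantumFieldTheory.Balaban1983to89.Node00.Record13Ax

/-!
# BalabanUVNodes ∕ N13 → K1ᴬ — N13's LEVEL-0 FACE OF (UV₁₃) AT THE RE-CENTRED Z WITNESS `theta13OfThm1CCMWZBAx … Efl logz` WITH THE PRINTED `z`: dag-n13-w1's
# `…N13UV01LevelZeroAtThm1CCMWZBOfPrintedZ` (the ONE N13 level-0 name the cofinal K1 ENGINE ✓p782234 consumes) under σ_Ax — witness `theta13OfThm1CCMWZB ↦ theta13OfThm1CCMWZBAx` (node00-def-Y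
# `Record13NumericsOfThm1CCMWZBChi`), letters `betaOfRecord₁₃ ∕ gOfRecord₁₃ ∕ chiβOfRecord₁₃ ↦ …Ax` (`[Ax-3a∕3b]`), `densOfRecord₁₃ θ ↦ densOfRecord₁₃Chi θ (chiβOfRecord₁₃Ax θ)`; proofs = the
# parent's one-liners onto this seat's χ-generic rows `…N13UV01LevelZeroAtRecord13Chi` with the cut-off hypothesis `χ ∈ [0,1]` discharged by `[Ax-2]`'s `chiFixed29Ax_eq_zero_or_one`
# (WORK ORDER RC-1, director-ym №462 (B) ∕ №467 (D); K1ᴬ stmt-QuantumFields-27239)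

Seat `pub-ymgap-dag-n24-c` g23 (op 5b ENGINE-LANE HAND; HANDS-3 (iv) precedent — no live N13 seat; `--kind proof --supports stmt-QuantumFields-27239 --as helper`, count-neutral).

WHAT IS HERE (theorems only; 0 `def`, 0 `sorry`, standard axioms): `chiβOfRecord₁₃Ax_mem_Icc` (the re-centred cut-off of the Ax Z witness takes values in `[0,1]`) · §1
`zItems_theta13OfThm1CCMWZBAx_printedZ` · ★★ `uv_zero_densOfRecord₁₃_theta13OfThm1CCMWZBAx_printedZ_of_eflAbs_of_inInterval_of_invSqFloor` · ★★
`uv_zero_densOfRecord₁₃_theta13OfThm1CCMWZBAx_printedZ_of_eflAbs_of_inInterval_of_runPartialSumFloor` (THE ENGINE's NAME: (2.50) at level 0 at the re-centred Z member with the printed `z`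
and any volume-bounded `Efl`, along a γ′-windowed run under NODE O's run-wise partial-sum floor (iv)) · §2 `…_eflZero_of_inInterval_of_invSqFloor`.  The `rfl` bridges of the parent
(the Z member's β ∕ histories do not read `Efl`, `logz`) hold verbatim for the Ax witness (its `ν`, `ε₂₉`, hence `chiβOfRecord₁₃Ax`, do not read them either).

HONEST FRAMING.  Bookkeeping; elementary level-0 arithmetic re-addressed; N13 NOT discharged; nothing of Bałaban asserted; K1ᴬ DECIDING ∕ OPEN, not claimed; counts unmoved (discharged 8∕27 · K 1∕4);
one finite 𝕋⁴ programme at fixed ε = L^{−K} — NOT continuum ∕ ℝ⁴ ∕ OS ∕ mass gap ∕ Clay.  No `def`, no `instance`, no `sorry`.  References (context): [V] = [Balaban1989LargeFieldII] (0.1)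
pp.355–356; [III] = [Balaban1988Convergent] Thm 1 p.262, (1.15) p.249, (2.50) p.264; [I] = [Balaban1987RG1] (0.14)–(0.20) pp.254–256, Thm 2 p.259, (2.9) p.266 with (2.3) p.265.
-/

noncomputable section

open scoped BigOperators

namespace Summit.QuantumFields.YangMills.BalabanUVNodes.N13UV01LevelZeroAtThm1CCMWZBAxOfPrintedZ

open MeasureTheory
open Literature.MathematicalPhysics.QuantumFieldTheory.Balaban1983to89
open Literature.MathematicalPhysics.QuantumFieldTheory.Balaban1983to89.T4Continuum
open Literature.MathematicalPhysics.QuantumFieldTheory.Balaban1983to89.Node00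
open Literature.MathematicalPhysics.QuantumFieldTheory.Balaban1983to89.FlowStepRuns (genFlow genSeq genSeq_zero)
open Literature.MathematicalPhysics.QuantumFieldTheory.Balaban1983to89.FlowStep (HBeta prefixOf RGEqH)
open Summit.QuantumFields.YangMills.BalabanUVNodes.N13UV01LevelZeroAtRecord13Chi
  (zItems_of_logz_eq_log_zNorm_chi uv_zero_densOfRecord₁₃_of_logz_zNorm_of_eflAbs_of_inInterval_of_invSqFloor_chi
   partialSumFloor_nonneg_of_inInterval_chi inv_sq_gOfRecord₁₃_le_of_inInterval_of_runPartialSumFloor_chi)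

/-! ## §0. The re-centred cut-off of the Ax Z witness lies in `[0, 1]` -/

/-- The re-centred β-slot cut-off of the Ax Z member takes values in `[0,1]` (`[Ax-2]`: `chiFixed29Ax ∈ {0,1}`). [cite: Balaban1987RG1, (2.9) p.266 with (2.3) p.265 (bookkeeping)] -/
theorem chiβOfRecord₁₃Ax_mem_Icc (F : T4Family) (N : ℕ) [NeZero N] (j : ℕ) (γ εbg ε₀ ε₂₉ B₃ B₃' a₀ a₁ : ℝ) (Efl logz : B12.RunParams → ℕ → ℝ)
    (K : ℕ) (g : ℕ → ℝ) (k : ℕ) (V : GaugeField (F.P K) k (SU N)) :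
    chiβOfRecord₁₃Ax F N (theta13OfThm1CCMWZBAx F N j γ εbg ε₀ ε₂₉ B₃ B₃' a₀ a₁ Efl logz) K g k V ∈ Set.Icc (0 : ℝ) 1 := by
  have e : chiβOfRecord₁₃Ax F N (theta13OfThm1CCMWZBAx F N j γ εbg ε₀ ε₂₉ B₃ B₃' a₀ a₁ Efl logz) K g k V =
      chiFixed29Ax F N (theta13OfThm1CCMWZBAx F N j γ εbg ε₀ ε₂₉ B₃ B₃' a₀ a₁ Efl logz).ν (theta13OfThm1CCMWZBAx F N j γ εbg ε₀ ε₂₉ B₃ B₃' a₀ a₁ Efl logz).ε₂₉ K g k V := rfl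
  rw [e]
  rcases chiFixed29Ax_eq_zero_or_one (F := F) (N := N) (theta13OfThm1CCMWZBAx F N j γ εbg ε₀ ε₂₉ B₃ B₃' a₀ a₁ Efl logz).ν
      (theta13OfThm1CCMWZBAx F N j γ εbg ε₀ ε₂₉ B₃ B₃' a₀ a₁ Efl logz).ε₂₉ K g k V with h | h
  · rw [h]; exact ⟨le_rfl, zero_le_one⟩
  · rw [h]; exact ⟨zero_le_one, le_rfl⟩

variable (F : T4Family) (N : ℕ) [NeZero N] (j : ℕ) (γ εbg ε₀ ε₂₉ B₃ B₃' a₀ a₁ : ℝ) (Efl logz : B12.RunParams → ℕ → ℝ)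

/-! ## §1 (The Z3 member's β ∕ histories do not read the letters `Efl`, `logz`: `betaOfRecord₁₃ (θZB … Efl logz) = betaOfRecord₁₃ (θZB … 0 0)` by `rfl` — DEF-1's `K1ZBWitnessBetaRadius.betaOfRecord₁₃_theta13OfThm1CCMWZB_tokens`; the histories `gOfRecord₁₃` likewise, by unfolding.)  The printed `z` as the open letter: both z-items, and (2.50) at level `0` for every volume-bounded `Efl` -/

/-- ★ **AT THE Z MEMBER WITH `logz P j := log z(g_j², ε)` ALONG THE BLIND MEMBER's HISTORY, BOTH z-ITEMS HOLD ON EVERY γ'-WINDOWED RUN** (`γ' ≤ 1`, `0 < ε`): z-LOWER with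
print's `aL = d(𝔤)`, `CzL = C_z^{SU}(N, ε)`; z-UPPER with `aU = CzU = 0`.  CLAIM-1's `zItems_of_logz_eq_log_zNorm` through the `rfl` bridges. [cite: Balaban1987RG1, (0.14)–(0.17) pp.254–255] -/
theorem zItems_theta13OfThm1CCMWZBAx_printedZ {ε : ℝ} (hε : 0 < ε) (P : B12.RunParams) {γ' : ℝ} (hγ' : γ' ≤ 1)
    (hI : (genFlow (betaOfRecord₁₃Ax F N (theta13OfThm1CCMWZBAx F N j γ εbg ε₀ ε₂₉ B₃ B₃' a₀ a₁ (fun _ _ => 0) (fun _ _ => 0))) P.g0).InInterval γ' P.K) :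
    (∀ i, i < P.K → ((dimSU N : ℕ) : ℝ) * Real.log (gOfRecord₁₃Ax F N (theta13OfThm1CCMWZBAx F N j γ εbg ε₀ ε₂₉ B₃ B₃' a₀ a₁ (fun _ _ => 0) (fun _ _ => 0)) P i) - B16ZLower.CzSU N ε ≤
        (theta13OfThm1CCMWZBAx F N j γ εbg ε₀ ε₂₉ B₃ B₃' a₀ a₁ Efl
          (fun p i => Real.log (B16ZLower.zNorm (SU N) (gOfRecord₁₃Ax F N (theta13OfThm1CCMWZBAx F N j γ εbg ε₀ ε₂₉ B₃ B₃' a₀ a₁ (fun _ _ => 0) (fun _ _ => 0)) p i ^ 2) ε))).logz P i) ∧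
      (∀ i, i < P.K → (theta13OfThm1CCMWZBAx F N j γ εbg ε₀ ε₂₉ B₃ B₃' a₀ a₁ Efl
          (fun p i => Real.log (B16ZLower.zNorm (SU N) (gOfRecord₁₃Ax F N (theta13OfThm1CCMWZBAx F N j γ εbg ε₀ ε₂₉ B₃ B₃' a₀ a₁ (fun _ _ => 0) (fun _ _ => 0)) p i ^ 2) ε))).logz P i ≤
        (0 : ℝ) * Real.log (gOfRecord₁₃Ax F N (theta13OfThm1CCMWZBAx F N j γ εbg ε₀ ε₂₉ B₃ B₃' a₀ a₁ (fun _ _ => 0) (fun _ _ => 0)) P i) + 0) :=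
  zItems_of_logz_eq_log_zNorm_chi (theta13OfThm1CCMWZBAx F N j γ εbg ε₀ ε₂₉ B₃ B₃' a₀ a₁ Efl
    (fun p i => Real.log (B16ZLower.zNorm (SU N) (gOfRecord₁₃Ax F N (theta13OfThm1CCMWZBAx F N j γ εbg ε₀ ε₂₉ B₃ B₃' a₀ a₁ (fun _ _ => 0) (fun _ _ => 0)) p i ^ 2) ε)))
    (chiβOfRecord₁₃Ax F N (theta13OfThm1CCMWZBAx F N j γ εbg ε₀ ε₂₉ B₃ B₃' a₀ a₁ Efl
    (fun p i => Real.log (B16ZLower.zNorm (SU N) (gOfRecord₁₃Ax F N (theta13OfThm1CCMWZBAx F N j γ εbg ε₀ ε₂₉ B₃ B₃' a₀ a₁ (fun _ _ => 0) (fun _ _ => 0)) p i ^ 2) ε)))) P hε (fun _ _ => rfl) hγ' hI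

/-- ★★ **(2.50) AT LEVEL `0` AT THE Z MEMBER WITH THE PRINTED `z` AND ANY VOLUME-BOUNDED `Efl`** (`|Efl_P(i)| ≤ C_E·|T₁^{(i+1)}|` for `i < K`), along a γ'-windowed run (`γ' ≤ 1`) under the
coupling floor `g_i⁻² ≤ g₀⁻² + M` (`0 ≤ M`): `χβ₀·exp(−g₀⁻²A^η₀ − em·|T₁^{(0)}|) ≤ ρ₀ ≤ exp(ep·|T₁^{(0)}|)`, `em = 4·max(log σ₀,0) + C_z^{SU}(N,ε) + C_E + 12g₀⁻²`, `ep = 4d(𝔤)(log g₀⁻¹ + M∕2)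
+ 4·max(−log σ₀,0) + C_E` — CLAIM-1 §5 at this `θ`. [cite: Balaban1989LargeFieldII, (0.1) pp.355–356; Balaban1988Convergent, (2.50) p.264, Thm 1 p.262, (1.15) p.249; Balaban1987RG1, (0.15) p.254, (0.20) p.256] -/
theorem uv_zero_densOfRecord₁₃_theta13OfThm1CCMWZBAx_printedZ_of_eflAbs_of_inInterval_of_invSqFloor {ε CE γ' M : ℝ} (hε : 0 < ε) (hCE : 0 ≤ CE) (hγ' : γ' ≤ 1) (hM : 0 ≤ M)
    (P : B12.RunParams) (hE : ∀ i, i < P.K → |Efl P i| ≤ CE * sitesCard (F.P P.K) (i + 1))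
    (hfl : ∀ i, i ≤ P.K → (gOfRecord₁₃Ax F N (theta13OfThm1CCMWZBAx F N j γ εbg ε₀ ε₂₉ B₃ B₃' a₀ a₁ (fun _ _ => 0) (fun _ _ => 0)) P i ^ 2)⁻¹ ≤ (P.g0 ^ 2)⁻¹ + M)
    (hI : (genFlow (betaOfRecord₁₃Ax F N (theta13OfThm1CCMWZBAx F N j γ εbg ε₀ ε₂₉ B₃ B₃' a₀ a₁ (fun _ _ => 0) (fun _ _ => 0))) P.g0).InInterval γ' P.K) (U : GaugeField (F.P P.K) 0 (SU N)) :
    chiβOfRecord₁₃Ax F N (theta13OfThm1CCMWZBAx F N j γ εbg ε₀ ε₂₉ B₃ B₃' a₀ a₁ (fun _ _ => 0) (fun _ _ => 0)) P.K (gOfRecord₁₃Ax F N (theta13OfThm1CCMWZBAx F N j γ εbg ε₀ ε₂₉ B₃ B₃' a₀ a₁ (fun _ _ => 0) (fun _ _ => 0)) P) 0 U *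
          Real.exp (-(1 / (gOfRecord₁₃Ax F N (theta13OfThm1CCMWZBAx F N j γ εbg ε₀ ε₂₉ B₃ B₃' a₀ a₁ (fun _ _ => 0) (fun _ _ => 0)) P 0)) ^ 2 *
              wilsonBGOfRecord F N (theta13OfThm1CCMWZBAx F N j γ εbg ε₀ ε₂₉ B₃ B₃' a₀ a₁ (fun _ _ => 0) (fun _ _ => 0)).εbg P 0 U
            - (4 * max (numerics7OfThm1CCM F.L j ε₀ B₃ B₃' a₀ a₁).logσ₀ 0 + B16ZLower.CzSU N ε + CE
                + 12 * (1 / gOfRecord₁₃Ax F N (theta13OfThm1CCMWZBAx F N j γ εbg ε₀ ε₂₉ B₃ B₃' a₀ a₁ (fun _ _ => 0) (fun _ _ => 0)) P 0) ^ 2) * (Fintype.card (Site (F.P P.K) 0) : ℝ)) ≤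
        densOfRecord₁₃Chi F N (theta13OfThm1CCMWZBAx F N j γ εbg ε₀ ε₂₉ B₃ B₃' a₀ a₁ Efl
          (fun p i => Real.log (B16ZLower.zNorm (SU N) (gOfRecord₁₃Ax F N (theta13OfThm1CCMWZBAx F N j γ εbg ε₀ ε₂₉ B₃ B₃' a₀ a₁ (fun _ _ => 0) (fun _ _ => 0)) p i ^ 2) ε))) (chiβOfRecord₁₃Ax F N (theta13OfThm1CCMWZBAx F N j γ εbg ε₀ ε₂₉ B₃ B₃' a₀ a₁ Efl
          (fun p i => Real.log (B16ZLower.zNorm (SU N) (gOfRecord₁₃Ax F N (theta13OfThm1CCMWZBAx F N j γ εbg ε₀ ε₂₉ B₃ B₃' a₀ a₁ (fun _ _ => 0) (fun _ _ => 0)) p i ^ 2) ε)))) P 0 U ∧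
      densOfRecord₁₃Chi F N (theta13OfThm1CCMWZBAx F N j γ εbg ε₀ ε₂₉ B₃ B₃' a₀ a₁ Efl
          (fun p i => Real.log (B16ZLower.zNorm (SU N) (gOfRecord₁₃Ax F N (theta13OfThm1CCMWZBAx F N j γ εbg ε₀ ε₂₉ B₃ B₃' a₀ a₁ (fun _ _ => 0) (fun _ _ => 0)) p i ^ 2) ε))) (chiβOfRecord₁₃Ax F N (theta13OfThm1CCMWZBAx F N j γ εbg ε₀ ε₂₉ B₃ B₃' a₀ a₁ Efl
          (fun p i => Real.log (B16ZLower.zNorm (SU N) (gOfRecord₁₃Ax F N (theta13OfThm1CCMWZBAx F N j γ εbg ε₀ ε₂₉ B₃ B₃' a₀ a₁ (fun _ _ => 0) (fun _ _ => 0)) p i ^ 2) ε)))) P 0 U ≤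
        Real.exp ((4 * ((dimSU N : ℕ) : ℝ) * (Real.log (gOfRecord₁₃Ax F N (theta13OfThm1CCMWZBAx F N j γ εbg ε₀ ε₂₉ B₃ B₃' a₀ a₁ (fun _ _ => 0) (fun _ _ => 0)) P 0)⁻¹ + M / 2)
            + 4 * max (-(numerics7OfThm1CCM F.L j ε₀ B₃ B₃' a₀ a₁).logσ₀) 0 + CE) * (Fintype.card (Site (F.P P.K) 0) : ℝ)) :=
  uv_zero_densOfRecord₁₃_of_logz_zNorm_of_eflAbs_of_inInterval_of_invSqFloor_chi
    (theta13OfThm1CCMWZBAx F N j γ εbg ε₀ ε₂₉ B₃ B₃' a₀ a₁ Efl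
      (fun p i => Real.log (B16ZLower.zNorm (SU N) (gOfRecord₁₃Ax F N (theta13OfThm1CCMWZBAx F N j γ εbg ε₀ ε₂₉ B₃ B₃' a₀ a₁ (fun _ _ => 0) (fun _ _ => 0)) p i ^ 2) ε)))
    (chiβOfRecord₁₃Ax F N (theta13OfThm1CCMWZBAx F N j γ εbg ε₀ ε₂₉ B₃ B₃' a₀ a₁ Efl
      (fun p i => Real.log (B16ZLower.zNorm (SU N) (gOfRecord₁₃Ax F N (theta13OfThm1CCMWZBAx F N j γ εbg ε₀ ε₂₉ B₃ B₃' a₀ a₁ (fun _ _ => 0) (fun _ _ => 0)) p i ^ 2) ε)))) P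
    (chiβOfRecord₁₃Ax_mem_Icc F N j γ εbg ε₀ ε₂₉ B₃ B₃' a₀ a₁ Efl _) hγ' hM hε hCE hfl hI (fun _ _ => rfl) hE U

/-- **THE SAME FROM ROW (iv) IN K1⁹'s INLINE SPELLING** (run-wise partial-sum floor of the blind member's `β` at level `γ₀`, `γ' ≤ γ₀`; p632548 §1 gives the coupling floor, `0 ≤ M`).
[cite: Balaban1989LargeFieldII, (0.1) pp.355–356; Balaban1988Convergent, (2.50) p.264; Balaban1987RG1, (0.20) p.256, Thm 2 p.259, (0.15) p.254] -/
theorem uv_zero_densOfRecord₁₃_theta13OfThm1CCMWZBAx_printedZ_of_eflAbs_of_inInterval_of_runPartialSumFloor {ε CE γ' γ₀ M : ℝ} (hε : 0 < ε) (hCE : 0 ≤ CE) (hγ' : γ' ≤ 1)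
    (hγ₀ : γ' ≤ γ₀) (P : B12.RunParams) (hE : ∀ i, i < P.K → |Efl P i| ≤ CE * sitesCard (F.P P.K) (i + 1))
    (hps : ∀ (n : ℕ) (gs : ℕ → ℝ), RGEqH n (betaOfRecord₁₃Ax F N (theta13OfThm1CCMWZBAx F N j γ εbg ε₀ ε₂₉ B₃ B₃' a₀ a₁ (fun _ _ => 0) (fun _ _ => 0))) gs → Step.InInterval γ₀ n gs →
      ∀ k, k ≤ n → -M ≤ ∑ i ∈ Finset.Ico k n, betaOfRecord₁₃Ax F N (theta13OfThm1CCMWZBAx F N j γ εbg ε₀ ε₂₉ B₃ B₃' a₀ a₁ (fun _ _ => 0) (fun _ _ => 0)) i (prefixOf gs i))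
    (hI : (genFlow (betaOfRecord₁₃Ax F N (theta13OfThm1CCMWZBAx F N j γ εbg ε₀ ε₂₉ B₃ B₃' a₀ a₁ (fun _ _ => 0) (fun _ _ => 0))) P.g0).InInterval γ' P.K) (U : GaugeField (F.P P.K) 0 (SU N)) :
    chiβOfRecord₁₃Ax F N (theta13OfThm1CCMWZBAx F N j γ εbg ε₀ ε₂₉ B₃ B₃' a₀ a₁ (fun _ _ => 0) (fun _ _ => 0)) P.K (gOfRecord₁₃Ax F N (theta13OfThm1CCMWZBAx F N j γ εbg ε₀ ε₂₉ B₃ B₃' a₀ a₁ (fun _ _ => 0) (fun _ _ => 0)) P) 0 U *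
          Real.exp (-(1 / (gOfRecord₁₃Ax F N (theta13OfThm1CCMWZBAx F N j γ εbg ε₀ ε₂₉ B₃ B₃' a₀ a₁ (fun _ _ => 0) (fun _ _ => 0)) P 0)) ^ 2 *
              wilsonBGOfRecord F N (theta13OfThm1CCMWZBAx F N j γ εbg ε₀ ε₂₉ B₃ B₃' a₀ a₁ (fun _ _ => 0) (fun _ _ => 0)).εbg P 0 U
            - (4 * max (numerics7OfThm1CCM F.L j ε₀ B₃ B₃' a₀ a₁).logσ₀ 0 + B16ZLower.CzSU N ε + CE
                + 12 * (1 / gOfRecord₁₃Ax F N (theta13OfThm1CCMWZBAx F N j γ εbg ε₀ ε₂₉ B₃ B₃' a₀ a₁ (fun _ _ => 0) (fun _ _ => 0)) P 0) ^ 2) * (Fintype.card (Site (F.P P.K) 0) : ℝ)) ≤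
        densOfRecord₁₃Chi F N (theta13OfThm1CCMWZBAx F N j γ εbg ε₀ ε₂₉ B₃ B₃' a₀ a₁ Efl
          (fun p i => Real.log (B16ZLower.zNorm (SU N) (gOfRecord₁₃Ax F N (theta13OfThm1CCMWZBAx F N j γ εbg ε₀ ε₂₉ B₃ B₃' a₀ a₁ (fun _ _ => 0) (fun _ _ => 0)) p i ^ 2) ε))) (chiβOfRecord₁₃Ax F N (theta13OfThm1CCMWZBAx F N j γ εbg ε₀ ε₂₉ B₃ B₃' a₀ a₁ Efl
          (fun p i => Real.log (B16ZLower.zNorm (SU N) (gOfRecord₁₃Ax F N (theta13OfThm1CCMWZBAx F N j γ εbg ε₀ ε₂₉ B₃ B₃' a₀ a₁ (fun _ _ => 0) (fun _ _ => 0)) p i ^ 2) ε)))) P 0 U ∧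
      densOfRecord₁₃Chi F N (theta13OfThm1CCMWZBAx F N j γ εbg ε₀ ε₂₉ B₃ B₃' a₀ a₁ Efl
          (fun p i => Real.log (B16ZLower.zNorm (SU N) (gOfRecord₁₃Ax F N (theta13OfThm1CCMWZBAx F N j γ εbg ε₀ ε₂₉ B₃ B₃' a₀ a₁ (fun _ _ => 0) (fun _ _ => 0)) p i ^ 2) ε))) (chiβOfRecord₁₃Ax F N (theta13OfThm1CCMWZBAx F N j γ εbg ε₀ ε₂₉ B₃ B₃' a₀ a₁ Efl
          (fun p i => Real.log (B16ZLower.zNorm (SU N) (gOfRecord₁₃Ax F N (theta13OfThm1CCMWZBAx F N j γ εbg ε₀ ε₂₉ B₃ B₃' a₀ a₁ (fun _ _ => 0) (fun _ _ => 0)) p i ^ 2) ε)))) P 0 U ≤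
        Real.exp ((4 * ((dimSU N : ℕ) : ℝ) * (Real.log (gOfRecord₁₃Ax F N (theta13OfThm1CCMWZBAx F N j γ εbg ε₀ ε₂₉ B₃ B₃' a₀ a₁ (fun _ _ => 0) (fun _ _ => 0)) P 0)⁻¹ + M / 2)
            + 4 * max (-(numerics7OfThm1CCM F.L j ε₀ B₃ B₃' a₀ a₁).logσ₀) 0 + CE) * (Fintype.card (Site (F.P P.K) 0) : ℝ)) :=
  uv_zero_densOfRecord₁₃_theta13OfThm1CCMWZBAx_printedZ_of_eflAbs_of_inInterval_of_invSqFloor F N j γ εbg ε₀ ε₂₉ B₃ B₃' a₀ a₁ Efl hε hCE hγ'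
    (partialSumFloor_nonneg_of_inInterval_chi (theta13OfThm1CCMWZBAx F N j γ εbg ε₀ ε₂₉ B₃ B₃' a₀ a₁ (fun _ _ => 0) (fun _ _ => 0)) (chiβOfRecord₁₃Ax F N (theta13OfThm1CCMWZBAx F N j γ εbg ε₀ ε₂₉ B₃ B₃' a₀ a₁ (fun _ _ => 0) (fun _ _ => 0))) P hγ₀ hps hI) P hE
    (inv_sq_gOfRecord₁₃_le_of_inInterval_of_runPartialSumFloor_chi (theta13OfThm1CCMWZBAx F N j γ εbg ε₀ ε₂₉ B₃ B₃' a₀ a₁ (fun _ _ => 0) (fun _ _ => 0)) (chiβOfRecord₁₃Ax F N (theta13OfThm1CCMWZBAx F N j γ εbg ε₀ ε₂₉ B₃ B₃' a₀ a₁ (fun _ _ => 0) (fun _ _ => 0))) P hγ₀ hps hI) hI U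

/-! ## §2 The hypothesis-free member: `Efl = 0`, `logz` printed -/

/-- ★★ **(2.50) AT LEVEL `0` AT THE Z MEMBER `theta13OfThm1CCMWZ … 0 logz_print` WITH NO HYPOTHESIS ON THE LETTERS** — `Efl = 0` is volume-bounded with `C_E = 0`; along a γ'-windowed run
(`γ' ≤ 1`) under the coupling floor: `em = 4·max(log σ₀,0) + C_z^{SU}(N,ε) + 12g₀⁻²`, `ep = 4d(𝔤)(log g₀⁻¹ + M∕2) + 4·max(−log σ₀,0)`.  A NON-coupling-blind member of DEF-1's Z family
with its level-0 face in the tree. [cite: Balaban1989LargeFieldII, (0.1) pp.355–356; Balaban1988Convergent, (2.50) p.264, Thm 1 p.262, (1.15) p.249; Balaban1987RG1, (0.15) p.254, (0.20) p.256] -/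
theorem uv_zero_densOfRecord₁₃_theta13OfThm1CCMWZBAx_printedZ_eflZero_of_inInterval_of_invSqFloor {ε γ' M : ℝ} (hε : 0 < ε) (hγ' : γ' ≤ 1) (hM : 0 ≤ M) (P : B12.RunParams)
    (hfl : ∀ i, i ≤ P.K → (gOfRecord₁₃Ax F N (theta13OfThm1CCMWZBAx F N j γ εbg ε₀ ε₂₉ B₃ B₃' a₀ a₁ (fun _ _ => 0) (fun _ _ => 0)) P i ^ 2)⁻¹ ≤ (P.g0 ^ 2)⁻¹ + M)
    (hI : (genFlow (betaOfRecord₁₃Ax F N (theta13OfThm1CCMWZBAx F N j γ εbg ε₀ ε₂₉ B₃ B₃' a₀ a₁ (fun _ _ => 0) (fun _ _ => 0))) P.g0).InInterval γ' P.K) (U : GaugeField (F.P P.K) 0 (SU N)) :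
    chiβOfRecord₁₃Ax F N (theta13OfThm1CCMWZBAx F N j γ εbg ε₀ ε₂₉ B₃ B₃' a₀ a₁ (fun _ _ => 0) (fun _ _ => 0)) P.K (gOfRecord₁₃Ax F N (theta13OfThm1CCMWZBAx F N j γ εbg ε₀ ε₂₉ B₃ B₃' a₀ a₁ (fun _ _ => 0) (fun _ _ => 0)) P) 0 U *
          Real.exp (-(1 / (gOfRecord₁₃Ax F N (theta13OfThm1CCMWZBAx F N j γ εbg ε₀ ε₂₉ B₃ B₃' a₀ a₁ (fun _ _ => 0) (fun _ _ => 0)) P 0)) ^ 2 *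
              wilsonBGOfRecord F N (theta13OfThm1CCMWZBAx F N j γ εbg ε₀ ε₂₉ B₃ B₃' a₀ a₁ (fun _ _ => 0) (fun _ _ => 0)).εbg P 0 U
            - (4 * max (numerics7OfThm1CCM F.L j ε₀ B₃ B₃' a₀ a₁).logσ₀ 0 + B16ZLower.CzSU N ε
                + 12 * (1 / gOfRecord₁₃Ax F N (theta13OfThm1CCMWZBAx F N j γ εbg ε₀ ε₂₉ B₃ B₃' a₀ a₁ (fun _ _ => 0) (fun _ _ => 0)) P 0) ^ 2) * (Fintype.card (Site (F.P P.K) 0) : ℝ)) ≤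
        densOfRecord₁₃Chi F N (theta13OfThm1CCMWZBAx F N j γ εbg ε₀ ε₂₉ B₃ B₃' a₀ a₁ (fun _ _ => 0)
          (fun p i => Real.log (B16ZLower.zNorm (SU N) (gOfRecord₁₃Ax F N (theta13OfThm1CCMWZBAx F N j γ εbg ε₀ ε₂₉ B₃ B₃' a₀ a₁ (fun _ _ => 0) (fun _ _ => 0)) p i ^ 2) ε))) (chiβOfRecord₁₃Ax F N (theta13OfThm1CCMWZBAx F N j γ εbg ε₀ ε₂₉ B₃ B₃' a₀ a₁ (fun _ _ => 0)
          (fun p i => Real.log (B16ZLower.zNorm (SU N) (gOfRecord₁₃Ax F N (theta13OfThm1CCMWZBAx F N j γ εbg ε₀ ε₂₉ B₃ B₃' a₀ a₁ (fun _ _ => 0) (fun _ _ => 0)) p i ^ 2) ε)))) P 0 U ∧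
      densOfRecord₁₃Chi F N (theta13OfThm1CCMWZBAx F N j γ εbg ε₀ ε₂₉ B₃ B₃' a₀ a₁ (fun _ _ => 0)
          (fun p i => Real.log (B16ZLower.zNorm (SU N) (gOfRecord₁₃Ax F N (theta13OfThm1CCMWZBAx F N j γ εbg ε₀ ε₂₉ B₃ B₃' a₀ a₁ (fun _ _ => 0) (fun _ _ => 0)) p i ^ 2) ε))) (chiβOfRecord₁₃Ax F N (theta13OfThm1CCMWZBAx F N j γ εbg ε₀ ε₂₉ B₃ B₃' a₀ a₁ (fun _ _ => 0)
          (fun p i => Real.log (B16ZLower.zNorm (SU N) (gOfRecord₁₃Ax F N (theta13OfThm1CCMWZBAx F N j γ εbg ε₀ ε₂₉ B₃ B₃' a₀ a₁ (fun _ _ => 0) (fun _ _ => 0)) p i ^ 2) ε)))) P 0 U ≤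
        Real.exp ((4 * ((dimSU N : ℕ) : ℝ) * (Real.log (gOfRecord₁₃Ax F N (theta13OfThm1CCMWZBAx F N j γ εbg ε₀ ε₂₉ B₃ B₃' a₀ a₁ (fun _ _ => 0) (fun _ _ => 0)) P 0)⁻¹ + M / 2)
            + 4 * max (-(numerics7OfThm1CCM F.L j ε₀ B₃ B₃' a₀ a₁).logσ₀) 0) * (Fintype.card (Site (F.P P.K) 0) : ℝ)) := by
  have h := uv_zero_densOfRecord₁₃_theta13OfThm1CCMWZBAx_printedZ_of_eflAbs_of_inInterval_of_invSqFloor F N j γ εbg ε₀ ε₂₉ B₃ B₃' a₀ a₁ (fun _ _ => 0)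
    hε le_rfl hγ' hM P (fun i _ => by simp) hfl hI U
  simp only [add_zero] at h
  exact h

end Summit.QuantumFields.YangMills.BalabanUVNodes.N13UV01LevelZeroAtThm1CCMWZBAxOfPrintedZ

end
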